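import Literature.Analysis.FluidPDE.ElgindiPolarL2Estimate
import Literature.Analysis.FluidPDE.ElgindiPolarEnergyTwo
import HarnessLib

/-!
# The second-order angular estimates of the polar model operator ([Elgindi2021] Proposition 7.1,
second half)

Topic `Literature/Analysis/FluidPDE`. Proof file (everything proved, no definitions, no named
facts) on the proof path of the named fact
`Literature.Analysis.FluidPDE.Elgindi.ElgindiGhoulMasmoudi2021_stabilityCore`
(`ElgindiStabilityDecomposition.lean`). T. M. Elgindi, Ann. of Math. 194 (2021) =
arXiv:1904.04795, §7.1 Proposition 7.1 and the end of its proof (p. 20):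

> "`|∂_θ(Ψ/cosθ)|_{L²} + |∂_θθΨ|_{L²} + α²|R²∂_RRΨ|_{L²} ≤ 100|F|_{L²}`" … "Thus,
> `|∂_θθΨ|² + (3/2)|∂_θΨ̃|² ≤ 21|∂_θΨ|² + |F||∂_θθΨ|`. Thus,
> `|∂_θθΨ|² + 3|∂_θΨ̃|² ≤ (2(21)(16)+1)|F|²` using (L2Est)."

A-priori form for the class `Ψ = cosθ·χ`, `χ ∈ C³(ℝ²)` compactly supported with `χ(R,0) = 0`,
`F = L(Ψ)`, `∫₀^{π/2}F(R,·)K = 0` for `R > 0`, `0 < α ≤ 1`: from the second energy identity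
(`integral_strip_ellipticOp_mul_neg_dθdθ`, with its exact `tan`-term) and the first half
(`integral_strip_sq_dθ_le`), `‖∂_θθΨ‖² ≤ 4‖F‖²` and `‖∂_θ(Ψ/cosθ)‖² = ‖χ_θ‖² ≤ 3‖F‖²`
(`integral_strip_sq_dθdθ_le`), with better constants than printed.
-/

noncomputable section

open MeasureTheory Set Real Filter Function intervalIntegral
open _root_.Topology

namespace Literature.Analysis.FluidPDE

namespace Elgindi

/-- **`‖∂_θθΨ‖² ≤ 4‖L(Ψ)‖²` and `‖∂_θ(Ψ/cosθ)‖² ≤ 3‖L(Ψ)‖²`** (Proposition 7.1, the angular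
second-order part, a-priori form for the class `Ψ = cosθ·χ`, `0 < α ≤ 1`). [cite: Elgindi2021, §7.1 Proposition 7.1 and the end of its proof (p. 20 of arXiv:1904.04795)] -/
theorem integral_strip_sq_dθdθ_le {α : ℝ} (hα : 0 < α) (hα1 : α ≤ 1) {χ : ℝ → ℝ → ℝ} (hχ : ContDiff ℝ 3 (uncurry χ))
    (hs : HasCompactSupport (uncurry χ)) (hχ0 : ∀ R, χ R 0 = 0) {Ψ : ℝ → ℝ → ℝ}
    (hΨ : Ψ = fun R θ => Real.cos θ * χ R θ)
    (horth : ∀ R, 0 < R → ∫ θ in Ioo 0 (π / 2), ellipticOp α Ψ R θ * kernelK θ = 0) :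
    (∫ p in strip, dθ (dθ Ψ) p.1 p.2 ^ 2) ≤ 4 * ∫ p in strip, ellipticOp α Ψ p.1 p.2 ^ 2 ∧
      (∫ p in strip, dθ χ p.1 p.2 ^ 2) ≤ 3 * ∫ p in strip, ellipticOp α Ψ p.1 p.2 ^ 2 := by
  have hχ2 : ContDiff ℝ 2 (uncurry χ) := hχ.of_le (by norm_num)
  have hχ1 : ContDiff ℝ 1 (uncurry χ) := hχ.of_le (by norm_num)
  have hΨ3 : ContDiff ℝ 3 (uncurry Ψ) := by rw [hΨ]; exact contDiff_cosProfile hχ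
  have hΨ2 : ContDiff ℝ 2 (uncurry Ψ) := hΨ3.of_le (by norm_num)
  have hΨs : HasCompactSupport (uncurry Ψ) := by rw [hΨ]; exact hasCompactSupport_cosProfile hs
  have hdzΨ : ContDiff ℝ 2 (uncurry (dz Ψ)) := contDiff_dz_of_contDiff (n := 2) hΨ3
  have hdθΨ : ContDiff ℝ 2 (uncurry (dθ Ψ)) := contDiff_dθ_of_contDiff (n := 2) hΨ3
  have hdθ2Ψ : ContDiff ℝ 1 (uncurry (dθ (dθ Ψ))) := contDiff_dθ_of_contDiff (n := 1) hdθΨ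
  have hdθχ : ContDiff ℝ 2 (uncurry (dθ χ)) := contDiff_dθ_of_contDiff (n := 2) hχ
  have hdθ2Ψs : HasCompactSupport (uncurry (dθ (dθ Ψ))) := hasCompactSupport_dθ_of (hasCompactSupport_dθ_of hΨs)
  have cΨ : Continuous fun p : ℝ × ℝ => Ψ p.1 p.2 := hΨ3.continuous
  have cχ : Continuous fun p : ℝ × ℝ => χ p.1 p.2 := hχ.continuous
  have cdz : Continuous fun p : ℝ × ℝ => dz Ψ p.1 p.2 := hdzΨ.continuous
  have cdz2 : Continuous fun p : ℝ × ℝ => dz (dz Ψ) p.1 p.2 := continuous_dz (hdzΨ.of_le (by norm_num))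
  have cdθ : Continuous fun p : ℝ × ℝ => dθ Ψ p.1 p.2 := hdθΨ.continuous
  have cdθ2 : Continuous fun p : ℝ × ℝ => dθ (dθ Ψ) p.1 p.2 := hdθ2Ψ.continuous
  have cdθχ : Continuous fun p : ℝ × ℝ => dθ χ p.1 p.2 := hdθχ.continuous
  -- first half and second identity
  have hfirst := integral_strip_sq_dθ_le hα hα1 hχ2 hs hχ0 hΨ horth
  have hE2 := integral_strip_ellipticOp_mul_neg_dθdθ α hχ hs hχ0 hΨ
  -- continuous compactly supported representative of `L(Ψ)` on the strip (as in the first half)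
  set G : ℝ × ℝ → ℝ := fun p => -α ^ 2 * p.1 ^ 2 * dz (dz Ψ) p.1 p.2 - α * (5 + α) * p.1 * dz Ψ p.1 p.2 -
    dθ (dθ Ψ) p.1 p.2 + (Real.cos p.2 * χ p.1 p.2 + Real.sin p.2 * dθ χ p.1 p.2) - 6 * Ψ p.1 p.2 with hG
  have cG : Continuous G := by simp only [hG]; fun_prop
  have hGeq : ∀ p ∈ strip, ellipticOp α Ψ p.1 p.2 = G p := by
    intro p hp
    have hcos : Real.cos p.2 ≠ 0 := (Real.cos_pos_of_mem_Ioo ⟨by linarith [hp.2.1, Real.pi_pos], hp.2.2⟩).ne'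
    have hT : Real.cos p.2 * χ p.1 p.2 / Real.cos p.2 ^ 2 +
        Real.sin p.2 * (-Real.sin p.2 * χ p.1 p.2 + Real.cos p.2 * dθ χ p.1 p.2) / Real.cos p.2 =
        Real.cos p.2 * χ p.1 p.2 + Real.sin p.2 * dθ χ p.1 p.2 := by
      rw [div_add_div _ _ (pow_ne_zero 2 hcos) hcos, div_eq_iff (mul_ne_zero (pow_ne_zero 2 hcos) hcos)]
      have := Real.sin_sq_add_cos_sq p.2
      linear_combination (-(Real.cos p.2 ^ 2 * χ p.1 p.2)) * this
    have hΨp : Ψ p.1 p.2 / Real.cos p.2 ^ 2 = Real.cos p.2 * χ p.1 p.2 / Real.cos p.2 ^ 2 := by rw [hΨ]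
    have hdθp : dθ Ψ p.1 p.2 = -Real.sin p.2 * χ p.1 p.2 + Real.cos p.2 * dθ χ p.1 p.2 := by rw [hΨ, dθ_cosProfile hχ1]
    have hud : DifferentiableAt ℝ (fun θ' => Ψ p.1 θ') p.2 :=
      ((hΨ2.comp (contDiff_const.prodMk contDiff_id)).differentiable (by simp)) p.2
    rw [ellipticOp_eq_expanded α hud hcos, hdθp, hΨp, hT]
  have hTΨ : tsupport (uncurry Ψ) ⊆ tsupport (uncurry χ) := by
    have e : uncurry Ψ = (fun p : ℝ × ℝ => Real.cos p.2) * uncurry χ := by rw [hΨ]; funext p; rfl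
    rw [e]; exact tsupport_mul_subset_right
  have hGs : HasCompactSupport G := by
    refine HasCompactSupport.of_support_subset_isCompact hs.isCompact fun p hp => ?_
    by_contra hT
    have h1 : χ p.1 p.2 = 0 := image_eq_zero_of_notMem_tsupport (f := uncurry χ) hT
    have h2 : Ψ p.1 p.2 = 0 := image_eq_zero_of_notMem_tsupport (f := uncurry Ψ) fun h => hT (hTΨ h)
    have h3 : dθ χ p.1 p.2 = 0 := image_eq_zero_of_notMem_tsupport (f := uncurry (dθ χ)) fun h => hT (tsupport_dθ_subset' χ h)
    have h4 : dz Ψ p.1 p.2 = 0 := image_eq_zero_of_notMem_tsupport (f := uncurry (dz Ψ)) fun h => hT (hTΨ (tsupport_dz_subset h))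
    have h5 : dz (dz Ψ) p.1 p.2 = 0 := image_eq_zero_of_notMem_tsupport (f := uncurry (dz (dz Ψ))) fun h =>
      hT (hTΨ (tsupport_dz_subset (tsupport_dz_subset h)))
    have h6 : dθ (dθ Ψ) p.1 p.2 = 0 := image_eq_zero_of_notMem_tsupport (f := uncurry (dθ (dθ Ψ))) fun h =>
      hT (hTΨ (tsupport_dθ_subset' Ψ (tsupport_dθ_subset' (dθ Ψ) h)))
    apply hp
    simp [hG, h1, h2, h3, h4, h5, h6]
  have sG2 : HasCompactSupport fun p : ℝ × ℝ => G p ^ 2 := by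
    have e : (fun p : ℝ × ℝ => G p ^ 2) = fun p => G p * G p := by funext p; ring
    rw [e]; exact hGs.mul_left
  have iG2 : IntegrableOn (fun p : ℝ × ℝ => G p ^ 2) strip := ((cG.pow 2).integrable_of_hasCompactSupport sG2).integrableOn
  have sP : HasCompactSupport fun p : ℝ × ℝ => dθ (dθ Ψ) p.1 p.2 ^ 2 := by
    have e : (fun p : ℝ × ℝ => dθ (dθ Ψ) p.1 p.2 ^ 2) = fun p => dθ (dθ Ψ) p.1 p.2 * dθ (dθ Ψ) p.1 p.2 := by funext p; ring
    rw [e]; exact hdθ2Ψs.mul_left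
  have iP : Integrable fun p : ℝ × ℝ => dθ (dθ Ψ) p.1 p.2 ^ 2 := (cdθ2.pow 2).integrable_of_hasCompactSupport sP
  have iGP : Integrable fun p : ℝ × ℝ => G p * (-dθ (dθ Ψ) p.1 p.2) :=
    (cG.mul cdθ2.neg).integrable_of_hasCompactSupport (hdθ2Ψs.neg).mul_left
  have iP' : IntegrableOn (fun p : ℝ × ℝ => (-dθ (dθ Ψ) p.1 p.2) ^ 2) strip := by
    refine (iP.integrableOn (s := strip)).congr_fun (fun p _ => by ring) measurableSet_strip
  -- Cauchy–Schwarz: `⟨LΨ, −Ψ_θθ⟩² ≤ ‖LΨ‖² ‖Ψ_θθ‖²`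
  have hCS := sq_integral_mul_le (μ := volume.restrict strip) iG2 iP' iGP.integrableOn
  have eL : ∫ p in strip, ellipticOp α Ψ p.1 p.2 * (-dθ (dθ Ψ) p.1 p.2) = ∫ p in strip, G p * (-dθ (dθ Ψ) p.1 p.2) :=
    setIntegral_congr_fun measurableSet_strip fun p hp => by rw [hGeq p hp]
  have eL2 : ∫ p in strip, ellipticOp α Ψ p.1 p.2 ^ 2 = ∫ p in strip, G p ^ 2 :=
    setIntegral_congr_fun measurableSet_strip fun p hp => by rw [hGeq p hp]
  have eP : ∫ p in strip, (-dθ (dθ Ψ) p.1 p.2) ^ 2 = ∫ p in strip, dθ (dθ Ψ) p.1 p.2 ^ 2 :=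
    integral_congr_ae (ae_of_all _ fun p => by ring)
  rw [eP] at hCS
  rw [eL2] at hfirst ⊢
  rw [eL] at hE2
  -- bookkeeping with explicit atoms
  have hL2nn : 0 ≤ ∫ p in strip, G p ^ 2 := integral_nonneg fun p => sq_nonneg _
  have hPnn : 0 ≤ ∫ p in strip, dθ (dθ Ψ) p.1 p.2 ^ 2 := integral_nonneg fun p => sq_nonneg _
  have hQnn : 0 ≤ ∫ p in strip, dθ χ p.1 p.2 ^ 2 := integral_nonneg fun p => sq_nonneg _
  have hYnn : 0 ≤ ∫ p in strip, dθ Ψ p.1 p.2 ^ 2 := integral_nonneg fun p => sq_nonneg _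
  have hZ : 0 ≤ ∫ p in strip, (p.1 * dz (dθ Ψ) p.1 p.2) ^ 2 := integral_nonneg fun p => sq_nonneg _
  have hX : 0 ≤ ∫ p in strip, χ p.1 p.2 ^ 2 := integral_nonneg fun p => sq_nonneg _
  have hYle := hfirst.1
  have hc0 : 0 ≤ α * (5 + α) / 2 - α ^ 2 := by nlinarith
  have h1 : 0 ≤ α ^ 2 * ∫ p in strip, (p.1 * dz (dθ Ψ) p.1 p.2) ^ 2 := mul_nonneg (sq_nonneg _) hZ
  have h2 : 0 ≤ (α * (5 + α) / 2 - α ^ 2) * ∫ p in strip, dθ Ψ p.1 p.2 ^ 2 := mul_nonneg hc0 hYnn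
  -- from the identity: `P + 3/2 Q ≤ I + 6Y ≤ I + 2 L2`
  have hmain : (∫ p in strip, dθ (dθ Ψ) p.1 p.2 ^ 2) + (3 / 2) * (∫ p in strip, dθ χ p.1 p.2 ^ 2) ≤
      (∫ p in strip, G p * (-dθ (dθ Ψ) p.1 p.2)) + 2 * ∫ p in strip, G p ^ 2 := by
    linarith [hE2, h1, h2, hX, hYle]
  have hI : (∫ p in strip, G p * (-dθ (dθ Ψ) p.1 p.2)) ^ 2 ≤ (∫ p in strip, G p ^ 2) * ∫ p in strip, dθ (dθ Ψ) p.1 p.2 ^ 2 := hCS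
  -- `P ≤ 4 L2`
  have hP : (∫ p in strip, dθ (dθ Ψ) p.1 p.2 ^ 2) ≤ 4 * ∫ p in strip, G p ^ 2 := by
    by_contra hlt
    have hlt' := not_le.1 hlt
    have h3 : (∫ p in strip, dθ (dθ Ψ) p.1 p.2 ^ 2) - 2 * (∫ p in strip, G p ^ 2) ≤ ∫ p in strip, G p * (-dθ (dθ Ψ) p.1 p.2) := by
      nlinarith
    have h4 : 0 ≤ (∫ p in strip, dθ (dθ Ψ) p.1 p.2 ^ 2) - 2 * (∫ p in strip, G p ^ 2) := by nlinarith
    have h5 := (pow_le_pow_left₀ h4 h3 2).trans hI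
    nlinarith
  refine ⟨hP, ?_⟩
  have hI4 : (∫ p in strip, G p * (-dθ (dθ Ψ) p.1 p.2)) ≤ 2 * ∫ p in strip, G p ^ 2 := by
    by_contra hlt
    have hlt' := not_le.1 hlt
    have h6 := hI.trans (mul_le_mul_of_nonneg_left hP hL2nn)
    nlinarith
  nlinarith

end Elgindi

end Literature.Analysis.FluidPDE
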